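import Mathlib
import Summits.NavierStokesRegularity.NavierStokesRegularity.Theorems.TypeIQuarterGateScarEnvelopeTypeISatelliteTowerEnvelopeLeaves

/-!
# Sketch (ns-idea-18 g2, lens «oqh») — COUNTABLE SCARS: a Cantor–Bendixson replacement for the
second kernel exclusion of `ScarEnvelopeTypeI` (stmt-NavierStokesRegularity-23843)

NS regularity is NOT proved here; nothing below proves 23843, `OneScarLeaf`-exclusion or
`CountableScarsAB`.  What IS kernel-checked (0 sorry):

* `isClosed_scarSet` — the final-time scar set `{y | ¬ RegPt U y}` of any field is closed;
* `regPt_zoom_of_regPt` — regularity transports FORWARD along a parabolic similarity about any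
  final-time centre (companion of the tree's `regPt_of_regPt_zoom_zero`);
* `exists_scar_near_of_noOneScarLeaf` — under the FIRST kernel exclusion `∀ M, ¬ OneScarLeaf M`,
  every scar of every A–B object is an ACCUMULATION point of scars (class invariance `abTower_zoom`);
* `not_countable_of_closed_of_acc` — Baire: a nonempty closed subset of `ℝ³` all of whose points
  are accumulation points of it is uncountable;
* `noRooted_of_noOneScarLeaf_of_countableScars`, `scarEnvelopeTypeI_of_noOneScarLeaf_of_countableScars`
  — hence `(∀ M, ¬ OneScarLeaf M) → CountableScarsAB → ScarEnvelopeTypeI` (via the tree's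
  `scarEnvelopeTypeI_of_noRooted`), i.e. `CountableScarsAB` may REPLACE `∀ M, ¬ InfiniteDescent M`.

`CountableScarsAB` is the `p = ∞` (sup-norm / Morrey Type-I) endpoint of the printed
«number of singular points at the blow-up time» programme (Neustupa 1999, Seregin 2001 `L^∞L³`;
Wang–Zhang 2012 Thm 5.3 `L^{q,∞}L^p`, `3<p<∞`; Choe–Wolf–Yang 2019 / Seregin 2019 / Barker–Prange 2021 /
Barker 2024 Thm 2 `L^∞L^{3,∞}`), asked as Barker's (Q.2) [arXiv:2111.14776 p.2].
-/

open MeasureTheory Set Metric Filter Topology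
open scoped ENNReal

namespace Summit.NavierStokesRegularity.NavierStokesRegularity.Cruxes.ScarEnvelopeTypeI.CountableScars

open Literature.Analysis.FluidPDE
open Summit.NavierStokesRegularity.NavierStokesRegularity.Cruxes.ScarEnvelopeTypeI.ZoomDictionary

local notation "E3" => EuclideanSpace ℝ (Fin 3)

/-- The final-time SCAR SET of an ancient field: the points `y` near `(0, y)` of which it is not
essentially bounded. -/
def scarSet (U : ℝ → E3 → E3) : Set E3 := {y | ¬ RegPt U y}

/-- **The proposed crux (replacement for `∀ M, ¬ InfiniteDescent M`)**: every A–B object (mild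
bounded ancient solution with sup-norm Type-I rate `M`, suitable in every ball, finite Morrey-type
Type-I quantity) has a COUNTABLE final-time scar set. -/
def CountableScarsAB : Prop :=
  ∀ (M : ℝ) (U : ℝ → E3 → E3) (P : ℝ → E3 → ℝ) (H : ℝ → E3 → E3 →L[ℝ] E3),
    ABTower M U P H → (scarSet U).Countable

/-- The weaker, purely topological form actually consumed by the assembly: no A–B object has a
nonempty scar set all of whose points are accumulation points of scars («no perfect scar set»). -/
def NoPerfectScarSetAB : Prop :=
  ∀ (M : ℝ) (U : ℝ → E3 → E3) (P : ℝ → E3 → ℝ) (H : ℝ → E3 → E3 →L[ℝ] E3),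
    ABTower M U P H → (scarSet U).Nonempty →
      ∃ y ∈ scarSet U, ∃ ρ : ℝ, 0 < ρ ∧ ∀ y' ∈ scarSet U, dist y' y < ρ → y' = y

/-! ## 1. The scar set is closed -/

/-- Regular final-time points form an open set: the witnessing cylinder of `y` serves `y'` near `y`
with half the radius. -/
theorem isOpen_regPt (U : ℝ → E3 → E3) : IsOpen {y : E3 | RegPt U y} := by
  rw [Metric.isOpen_iff]
  rintro y ⟨r, hr, M, hM⟩
  refine ⟨r / 2, by positivity, fun y' hy' => ?_⟩
  rw [mem_ball] at hy'
  refine ⟨r / 2, by positivity, M, ?_⟩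
  have hsub : parabolicCylinder (r / 2) (((0 : ℝ), y') : ℝ × E3) ⊆
      parabolicCylinder r (((0 : ℝ), y) : ℝ × E3) := by
    intro w hw
    rw [mem_parabolicCylinder] at hw ⊢
    obtain ⟨⟨h1, h2⟩, h3⟩ := hw
    refine ⟨⟨?_, h2⟩, ?_⟩
    · have : (r / 2) ^ 2 ≤ r ^ 2 := by nlinarith
      simp only at h1 ⊢
      linarith
    · calc dist w.2 y ≤ dist w.2 y' + dist y' y := dist_triangle _ _ _
        _ < r / 2 + r / 2 := by simp only at h3; exact add_lt_add h3 hy'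
        _ = r := by ring
  exact ae_restrict_of_ae_restrict_of_subset hsub hM

/-- The scar set is closed. -/
theorem isClosed_scarSet (U : ℝ → E3 → E3) : IsClosed (scarSet U) := by
  have : scarSet U = {y : E3 | RegPt U y}ᶜ := rfl
  rw [this]
  exact (isOpen_regPt U).isClosed_compl

/-! ## 2. Regularity transports forward along parabolic similarities about any centre -/

/-- If `U` is regular at `(0, y₀ + c y)` then the zoom `zoom U y₀ 0 c = c • U(c² ·, y₀ + c ·)` is
regular at `(0, y)`. -/
theorem regPt_zoom_of_regPt {c : ℝ} (hc0 : 0 < c) {U : ℝ → E3 → E3} {y₀ y : E3}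
    (h : RegPt U (y₀ + c • y)) : RegPt (zoom U y₀ 0 c) y := by
  obtain ⟨r, hr, M, hM⟩ := h
  refine ⟨c⁻¹ * r, by positivity, c * M, ?_⟩
  have hpre : stAffine (c ^ 2) c 0 y₀ ⁻¹' parabolicCylinder r (((0 : ℝ), y₀ + c • y) : ℝ × E3) =
      parabolicCylinder (c⁻¹ * r) (((0 : ℝ), y) : ℝ × E3) := by
    have h1 := LocalTypeIScaling.stAffine_preimage_parabolicCylinder hc0 (0 : ℝ) y₀ (c⁻¹ * r)
      (((0 : ℝ), y) : ℝ × E3)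
    have e : stAffine (c ^ 2) c 0 y₀ (((0 : ℝ), y) : ℝ × E3) = ((0 : ℝ), y₀ + c • y) := by
      rw [stAffine_apply, mul_zero, add_zero]
    rw [e, show c * (c⁻¹ * r) = r by field_simp] at h1
    exact h1
  have h2 := ae_restrict_preimage_stAffine (pow_pos hc0 2) hc0 (0 : ℝ) y₀ hM
  rw [hpre] at h2
  filter_upwards [h2] with z hz
  obtain ⟨s, y'⟩ := z
  rw [stAffine_apply] at hz
  dsimp only at hz
  show ‖c • U (0 + c ^ 2 * s) (y₀ + c • y')‖ ≤ c * M
  rw [norm_smul, Real.norm_of_nonneg hc0.le]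
  exact mul_le_mul_of_nonneg_left hz hc0.le

/-! ## 3. Under the first exclusion, scars accumulate -/

/-- **No isolated scars under `∀ M, ¬ OneScarLeaf M`.**  Zoom about the scar `y₀` with factor `ρ`
(`abTower_zoom` keeps the class and the rate, `regPt_of_regPt_zoom_zero` keeps the scar at the new
origin); the exclusion produces a satellite of the zoomed object in the unit ball, i.e. a scar of
`U` in `B(y₀, ρ) ∖ {y₀}`. -/
theorem exists_scar_near_of_noOneScarLeaf (hE1 : ∀ M : ℝ, ¬ OneScarLeaf M) {M : ℝ}
    {U : ℝ → E3 → E3} {P : ℝ → E3 → ℝ} {H : ℝ → E3 → E3 →L[ℝ] E3} (hAB : ABTower M U P H)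
    {y₀ : E3} (hy₀ : ¬ RegPt U y₀) {ρ : ℝ} (hρ : 0 < ρ) :
    ∃ y : E3, y ≠ y₀ ∧ dist y y₀ < ρ ∧ ¬ RegPt U y := by
  have hAB' := abTower_zoom hAB y₀ hρ
  have h0 : ¬ RegPt (ρ • stPull (ρ ^ 2) ρ (0 : ℝ) y₀ U) 0 := by
    intro h
    refine hy₀ (regPt_of_regPt_zoom_zero hρ ?_)
    rwa [zoom_eq_smul_stPull]
  have h1 := hE1 M
  simp only [OneScarLeaf, not_exists, not_and] at h1
  have h3 := h1 _ _ _ hAB' h0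
  push_neg at h3
  obtain ⟨y, hy0, hy1, hyreg⟩ := h3
  refine ⟨y₀ + ρ • y, ?_, ?_, fun h => hyreg ?_⟩
  · intro heq
    apply hy0
    have : ρ • y = 0 := by simpa using heq
    exact (smul_eq_zero.1 this).resolve_left hρ.ne'
  · rw [dist_eq_norm, add_sub_cancel_left, norm_smul, Real.norm_of_nonneg hρ.le]
    calc ρ * ‖y‖ < ρ * 1 := mul_lt_mul_of_pos_left hy1 hρ
      _ = ρ := mul_one ρ
  · rw [← zoom_eq_smul_stPull]
    exact regPt_zoom_of_regPt hρ h

/-- **Dichotomy (typed).** Under the first kernel exclusion the final-time scar set of every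
Albritton–Barker object is a PERFECT set (closed and dense-in-itself; Mathlib `Perfect`, which
allows `∅`): no limits are taken — (E1) is applied to exact zooms of the same object. -/
theorem perfect_scarSet_of_noOneScarLeaf (hE1 : ∀ M : ℝ, ¬ OneScarLeaf M) {M : ℝ}
    {U : ℝ → E3 → E3} {P : ℝ → E3 → ℝ} {H : ℝ → E3 → E3 →L[ℝ] E3}
    (hAB : ABTower M U P H) : Perfect (scarSet U) := by
  refine ⟨isClosed_scarSet U, (preperfect_iff_nhds).2 fun y hy V hV => ?_⟩
  obtain ⟨ρ, hρ, hball⟩ := Metric.mem_nhds_iff.1 hV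
  obtain ⟨y', hne, hd, hy'⟩ := exists_scar_near_of_noOneScarLeaf hE1 hAB hy hρ
  exact ⟨y', ⟨hball (Metric.mem_ball.2 hd), hy'⟩, hne⟩

/-! ## 4. Baire: closed + dense-in-itself + nonempty ⇒ uncountable -/

/-- A nonempty closed subset of `ℝ³` each of whose points is an accumulation point of it is not
countable (Baire category in the complete subspace; Cantor–Bendixson). -/
theorem not_countable_of_closed_of_acc {S : Set E3} (hcl : IsClosed S) (hne : S.Nonempty)
    (hacc : ∀ y ∈ S, ∀ ρ : ℝ, 0 < ρ → ∃ y' ∈ S, y' ≠ y ∧ dist y' y < ρ) : ¬ S.Countable := by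
  intro hcount
  haveI : IsClosed S := hcl
  haveI : Countable S := hcount.to_subtype
  haveI : Nonempty S := hne.to_subtype
  obtain ⟨p₀, hint⟩ := nonempty_interior_of_iUnion_of_closed (X := S)
    (f := fun p : S => ({p} : Set S)) (fun p => isClosed_singleton) (by ext p; simp)
  have heq : interior ({p₀} : Set S) = {p₀} :=
    (subset_singleton_iff_eq.mp interior_subset).resolve_left hint.ne_empty
  have hopen : IsOpen ({p₀} : Set S) := heq ▸ isOpen_interior
  rw [Metric.isOpen_iff] at hopen
  obtain ⟨ε, hε, hball⟩ := hopen p₀ rfl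
  obtain ⟨y', hy'S, hne', hdist⟩ := hacc p₀.1 p₀.2 ε hε
  have hmem : (⟨y', hy'S⟩ : S) ∈ ball p₀ ε := by
    rw [mem_ball]
    exact hdist
  have h1 := hball hmem
  rw [mem_singleton_iff] at h1
  exact hne' (congrArg Subtype.val h1)

/-! ## 5. Assembly -/

/-- Under the first exclusion, «countable scar sets» and «no perfect scar set» say the same. -/
theorem noPerfectScarSet_of_countableScars
    (hC : CountableScarsAB) : NoPerfectScarSetAB := by
  intro M U P H hAB hne
  by_contra hcon
  push_neg at hcon
  refine not_countable_of_closed_of_acc (isClosed_scarSet U) hne (fun y hy ρ hρ => ?_) (hC M U P H hAB)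
  obtain ⟨y', hy', hd, hne'⟩ := hcon y hy ρ hρ
  exact ⟨y', hy', hne', hd⟩

/-- **No rooted node** under the first exclusion and «no perfect scar set»: a rooted node's field
has the origin in its scar set, which is closed (§1) and dense-in-itself (§3). -/
theorem noRooted_of_noOneScarLeaf_of_noPerfectScarSet (hE1 : ∀ M : ℝ, ¬ OneScarLeaf M)
    (hN : NoPerfectScarSetAB) : ∀ (M : ℝ) (n : TNode), ¬ RootedNode M n := by
  intro M n hn
  have hAB : ABTower M n.U n.P n.H := hn.1.1
  have h0 : (0 : E3) ∈ scarSet n.U := hn.2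
  obtain ⟨y, hy, ρ, hρ, hiso⟩ := hN M n.U n.P n.H hAB ⟨0, h0⟩
  obtain ⟨y', hne, hd, hy'⟩ := exists_scar_near_of_noOneScarLeaf hE1 hAB hy hρ
  exact hne (hiso y' hy' hd)

/-- Same, from countability. -/
theorem noRooted_of_noOneScarLeaf_of_countableScars (hE1 : ∀ M : ℝ, ¬ OneScarLeaf M)
    (hC : CountableScarsAB) : ∀ (M : ℝ) (n : TNode), ¬ RootedNode M n :=
  noRooted_of_noOneScarLeaf_of_noPerfectScarSet hE1 (noPerfectScarSet_of_countableScars hC)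

/-- **THE REPLACEMENT**: the first kernel exclusion together with COUNTABLE SCARS decides the crux
item 23843 (tree: `scarEnvelopeTypeI_of_noRooted`). -/
theorem scarEnvelopeTypeI_of_noOneScarLeaf_of_countableScars (hE1 : ∀ M : ℝ, ¬ OneScarLeaf M)
    (hC : CountableScarsAB) :
    Summit.NavierStokesRegularity.NavierStokesRegularity.Theses.TypeIQuarterGate.ScarEnvelopeTypeI :=
  scarEnvelopeTypeI_of_noRooted (noRooted_of_noOneScarLeaf_of_countableScars hE1 hC)

/-- The purely topological variant. -/
theorem scarEnvelopeTypeI_of_noOneScarLeaf_of_noPerfectScarSet (hE1 : ∀ M : ℝ, ¬ OneScarLeaf M)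
    (hN : NoPerfectScarSetAB) :
    Summit.NavierStokesRegularity.NavierStokesRegularity.Theses.TypeIQuarterGate.ScarEnvelopeTypeI :=
  scarEnvelopeTypeI_of_noRooted (noRooted_of_noOneScarLeaf_of_noPerfectScarSet hE1 hN)

/-- **Honest strength.** Under the first exclusion, «countable scars» is equivalent to «no scars at
all» for Albritton–Barker objects (Cantor–Bendixson): the replacement (C) is not logically weaker
than what the kernel needs — its merit is its FORM (one object, one time slice, a counting
statement with printed engines in neighbouring classes), not its strength. -/
theorem countableScarsAB_iff_noScars_of_noOneScarLeaf (hE1 : ∀ M : ℝ, ¬ OneScarLeaf M) :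
    CountableScarsAB ↔
      ∀ (M : ℝ) (U : ℝ → E3 → E3) (P : ℝ → E3 → ℝ) (H : ℝ → E3 → E3 →L[ℝ] E3),
        ABTower M U P H → scarSet U = ∅ := by
  constructor
  · intro hC M U P H hAB
    by_contra hne
    have hne' : (scarSet U).Nonempty := Set.nonempty_iff_ne_empty.2 hne
    refine not_countable_of_closed_of_acc (isClosed_scarSet U) hne' (fun y hy ρ hρ => ?_)
      (hC M U P H hAB)
    obtain ⟨y', hne'', hd, hy'⟩ := exists_scar_near_of_noOneScarLeaf hE1 hAB hy hρ
    exact ⟨y', hy', hne'', hd⟩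
  · intro h M U P H hAB
    rw [h M U P H hAB]
    exact Set.countable_empty

/-! ## 6. The first OPEN rung quoted on the card (statement only; the METHOD CEILING of additive
budgets — Minkowski-type packing of scars, dimension ≤ 1; NOT progress on (C) by itself) -/

/-- «Packing bound»: for Albritton–Barker objects of class `M`, `r`-separated final-time scars in
`B_ρ(0)` number at most `C(M) · ρ / r`. Expected from Kang–Miura–Tsai-type scaled-energy
concentration at every scar plus the Morrey slice budget; consistent with CKN `𝒫¹ = 0` and with
perfect `ℋ¹`-null dusts, hence useless alone (see the card's ENGINE GAP). -/
def PackingBoundAB : Prop :=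
  ∀ M : ℝ, ∃ C : ℝ, ∀ (U : ℝ → E3 → E3) (P : ℝ → E3 → ℝ) (H : ℝ → E3 → E3 →L[ℝ] E3),
    ABTower M U P H → ∀ ρ r : ℝ, 0 < r → r ≤ ρ → ∀ F : Finset E3,
      (↑F ⊆ scarSet U ∩ Metric.ball (0 : E3) ρ) →
      (∀ y ∈ F, ∀ y' ∈ F, y ≠ y' → r ≤ dist y y') → (F.card : ℝ) ≤ C * ρ / r

end Summit.NavierStokesRegularity.NavierStokesRegularity.Cruxes.ScarEnvelopeTypeI.CountableScars
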